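import Literature.Computability.AlgebraicComplexity.LandsbergRessayreThm21Proofs
import Literature.Computability.AlgebraicComplexity.LR17EquivariantRepresentations
import Literature.Computability.AlgebraicComplexity.LR17ExteriorDetReprEquivariance
import HarnessLib

/-!
# Landsberg–Ressayre 2017, Thms. 2.13 and 2.14 — the LOWER BOUNDS for regular equivariant
  determinantal representations of `det_m`: `lr_thm_2_14_ge` and `lr_thm_2_13_ge` hold

Topic `Literature/Computability/AlgebraicComplexity`.  DISCHARGE of the two named facts of
`LR17EquivariantRepresentations.lean` (LR17 §2.5, p0006:L127–L139):

* `lr_thm_2_14_ge_holds` — **LR17 Thm. 2.14, `≥`**: a REGULAR affine determinantal representation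
  `Ã : M_m(ℂ) → M_n(ℂ)` of `det_m` which is equivariant (exact lifts) for left multiplication by
  `GL(E)` (`leftLinearSubst ℂ m`) has `n ≥ 2^m - 1`;
* `lr_thm_2_13_ge_holds` — **LR17 Thm. 2.13, `≥`**: a REGULAR affine determinantal representation of
  `det_m` equivariant for the full realised symmetry group `𝔾_{det_m}` (`detSymmetrySubst ℂ m`) has
  `n ≥ C(2m, m) - 1`.

With `LR17.regularEquivariantDetComplexity_detPoly_eq` (`LR17ExteriorDetReprEquivariance.lean`,
which takes `(hge : lr_thm_2_14_ge)`) Thm. 2.14 is now unconditional in the tree: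
`srdc_{GL(E)}(det_m) = 2^m - 1` (`LR17.regularEquivariantDetComplexity_detPoly_eq_two_pow_sub_one`,
appended below); Thm. 2.13's equality waits only for the construction `lr_prop_2_17`
(`lr_thm_2_13_eq_of_prop_2_17`).

## The proof, and how it relates to the printed one

LR print a representation-theoretic proof of Thm. 2.14 (p0012:L85–p0013:L38: normal form
`Λ = Λ_{n-1}`, a connected reductive `L ≤ GL(ℓ₂) × GL(ℍ)` mapping onto `GL(E)`, a finite cover
`ℂ* × SL(E)`, then a chain of irreducible `SL(E)`-modules `ℍ₁, …, ℍ_k ⊆ ℍ` forced by the Pieri rule to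
be `Λ¹E, …, Λ^{m-1}E`, so `dim ℍ ≥ 2^m - 2`; the case `m = 2` apart, p0012:L126–L129) and OMIT the
proof of Thm. 2.13 ("very similar", cf. p0015:L115–L116 for the pattern).  The tree does NOT follow
this road.  Its proofs of the permanent theorems LR17 Thm. 2.8 (`lr_left_equivariant_lower_holds`,
`LandsbergRessayreProofs.lean`) and Thm. 2.1 (`lr_full_equivariant_lower_holds`,
`LandsbergRessayreThm21Proofs.lean`) run on ELEMENTARY engines — the canonical subspaces of the pencil
`Λ + Σ x_{kj} A_{kj}`, ONE generic torus element `diag(2, 3, 5, …)` and its exact lift, the exact lifts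
of the permutations, and a weight count (`LRPencil.TorusData.two_pow_sub_one_le_finrank`: `2^m - 1`
distinct occurring weights; `LRPencil.TorusData₂.choose_sub_one_le_finrank`: `C(2m,m) - 1`) — and
these engines never mention the permanent: `perm_m` enters the two assemblies only through

1. REGULARITY `rank Ã(0) = n - 1` (for `perm_m` a theorem, von zur Gathen 1987 = LR17 Lemma 3.2;
   for `det_m` it is false in general — the trivial representation — and is exactly the HYPOTHESIS
   "regular" of Thms. 2.13/2.14, LR17 Def. 2.12, p0006:L112–L116);
2. `perm_m(0) = 0` (so `n ≥ 1`) and `perm_m(Id) = 1 ≠ 0` (an invertible member of the pencil) —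
   equally true of `det_m`;
3. (Thm. 2.1 only) the torus CHARACTER: `perm_m(diag(d)·x·diag(e)) = (∏ d ∏ e)·perm_m(x)`
   (`LRPencil.linSubst_diagonal_perPoly`, LR17 Lemma 3.1/3.3) — for `det_m` the same identity
   `det(diag(d) x diag(e)) = ∏ d ∏ e · det x` (`LRPencil.linSubst_diagonal_detPoly` below);
4. the symmetry group: the left monomial symmetries `N(T^{GL(E)})` resp. the monomial pairs, which
   lie in `GL(E)` resp. `𝔾_{det_m}` (`leftMonomialSubst_le_leftLinearSubst`, tree;
   `permSymmetrySubst_le_detSymmetrySubst`, here), and equivariance is antitone in the group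
   (`IsEquivariantDetRepr.anti`).

So this file (i) restates the two assemblies for an ARBITRARY polynomial `f` on `M_m` with
regularity, `n ≥ 1`, a point `v` with `f(v) ≠ 0` and (two-sided case) the torus character identity
as hypotheses — `LRPencil.two_pow_sub_one_le_of_isRegular_of_eval_ne_zero`,
`LRPencil.exists_torusData₂_of_isRegular`, `LRPencil.choose_sub_one_le_of_isRegular` — the proofs
being those of `two_pow_sub_one_le_of_isRegular` / `LRPencil.exists_torusData₂` /
`choose_sub_one_le_of_isEquivariantDetRepr` with `perm_m ↦ f`; and (ii) specialises to `det_m`.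
As in the permanent files, LR's equivariance (lifts chosen in `𝔾_{det_n}`) is implied by the tree's
exact-lift `IsEquivariantDetRepr`, so the bounds are the printed ones for the tree's notion (the
notion in which the two named facts are typed).  No lower bound on `m` is needed (`m = 0`: the bounds
read `0 ≤ n`; the printed separate treatment of `m = 2` in Thm. 2.14 is not needed by the weight count).

Everything is proved; no named facts, no new definitions.

## References

* J. M. Landsberg, N. Ressayre, *Permanent v. determinant: an exponential lower bound assuming
  symmetry and a potential path towards Valiant's conjecture*, Differential Geom. Appl. 55 (2017)
  146–166, arXiv:1508.05788: Def. 1.3, Def. 2.12, Thm. 2.13, Thm. 2.14 (p0006:L107–L142), proof of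
  Thm. 2.14 p0012:L85–p0013:L38, Lemma 3.1, §6.
-/

noncomputable section

namespace Literature.Computability.AlgebraicComplexity

namespace LRPencil

open _root_.Matrix MvPolynomial Finset Module.End
open scoped Kronecker

/-! ### Generic inputs: positive size, an injective member of the pencil -/

section Generic

variable {m n : ℕ} {f : MvPolynomial (Fin m × Fin m) ℂ}
  {A : Matrix (Fin n) (Fin n) (MvPolynomial (Fin m × Fin m) ℂ)}

/-- A determinantal representation of a polynomial vanishing at the origin has positive size
(`det` of the empty matrix is `1`). [folklore] -/
private theorem pos_of_det_eq_of_eval_zero (hdet : A.det = f) (hf : MvPolynomial.eval 0 f = 0) : 0 < n := by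
  rcases Nat.eq_zero_or_pos n with h0 | h0
  · subst h0
    exfalso
    have h3 : A.det = 1 := Matrix.det_isEmpty
    have h4 := congrArg (MvPolynomial.eval (0 : Fin m × Fin m → ℂ)) hdet
    rw [h3, map_one, hf] at h4
    exact one_ne_zero h4
  · exact h0

/-- `Ã(v)` is an injective member of the pencil of an affine determinantal representation of `f`
whenever `f(v) ≠ 0` (`det Ã(v) = f(v)`). [folklore] -/
private theorem exists_injective_member_of_eval_ne_zero (haff : ∀ r c, (A r c).totalDegree ≤ 1)
    (hdet : A.det = f) {v : Fin m × Fin m → ℂ} (hv : MvPolynomial.eval v f ≠ 0) :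
    ∃ x : Fin m → Fin m → ℂ, Function.Injective
      (Matrix.toLin' (constPart A) + ∑ k, ∑ j, x k j • Matrix.toLin' (coeffMat A (k, j))) := by
  classical
  refine ⟨fun k j => v (k, j), ?_⟩
  have hmat : Matrix.toLin' (constPart A) + ∑ k, ∑ j, v (k, j) • Matrix.toLin' (coeffMat A (k, j)) =
      Matrix.toLin' (A.map (MvPolynomial.eval v)) := by
    rw [map_eval_eq A haff v, map_add, map_sum, Fintype.sum_prod_type]
    simp only [map_smul]
  have hdetv : (A.map (MvPolynomial.eval v)).det ≠ 0 := by
    have e : (A.map (MvPolynomial.eval v)).det = MvPolynomial.eval v A.det := by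
      rw [RingHom.map_det]; rfl
    rw [e, hdet]; exact hv
  rw [hmat]
  have hunit : IsUnit (A.map (MvPolynomial.eval v)) :=
    (Matrix.isUnit_iff_isUnit_det _).2 (isUnit_iff_ne_zero.2 hdetv)
  intro x y hxy
  apply Matrix.mulVec_injective_iff_isUnit.2 hunit
  simpa [Matrix.toLin'_apply] using hxy

/-- If `f(v) ≠ 0` for some `v` then `f ≠ 0`. [folklore] -/
private theorem ne_zero_of_eval_ne_zero {v : Fin m × Fin m → ℂ} (hv : MvPolynomial.eval v f ≠ 0) : f ≠ 0 := by
  rintro rfl; exact hv (map_zero _)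

end Generic

/-! ### LR17 Thm. 2.8's engine for an arbitrary polynomial with a regular representation -/

section OneSided

variable {m n : ℕ} {f : MvPolynomial (Fin m × Fin m) ℂ}
  {A : Matrix (Fin n) (Fin n) (MvPolynomial (Fin m × Fin m) ℂ)}

/-- **LR17 Thm. 2.8 / Thm. 2.14 for regular representations, generic form** (the tree's elementary
proof of Thm. 2.8, `two_pow_sub_one_le_of_isRegular`, with `perm_m` replaced by any `f`): a REGULAR
affine determinantal representation `Ã` of a polynomial `f` on `M_m(ℂ)` (`m ≥ 1`, size `n ≥ 1`)
which is equivariant — exact lifts — for the left monomial symmetries `x ↦ P_σ diag(c) x`, and some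
member `Ã(v)` of whose pencil is invertible (`f(v) ≠ 0`), has size `n ≥ 2^m - 1`: the torus element
`diag(2,3,5,…)`, its lift, the permutation lifts and the kernel line give a `TorusData` whose
`2^m - 1` weights are distinct and occur (`TorusData.two_pow_sub_one_le_finrank`).
[cite: LandsbergRessayre2017, Thm. 2.14] -/
theorem two_pow_sub_one_le_of_isRegular_of_eval_ne_zero (hm : 1 ≤ m)
    (hA : IsEquivariantDetRepr (leftMonomialSubst ℂ m) f A) (hreg : IsRegularDetRepr f A)
    (hn : 0 < n) {v : Fin m × Fin m → ℂ} (hv : MvPolynomial.eval v f ≠ 0) : 2 ^ m - 1 ≤ n := by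
  classical
  have haff : ∀ r c, (A r c).totalDegree ≤ 1 := hA.1.1
  have hdet : A.det = f := hA.1.2
  set Λm : Matrix (Fin n) (Fin n) ℂ := constPart A with hΛm
  set Am : Fin m → Fin m → Matrix (Fin n) (Fin n) ℂ := fun k j => coeffMat A (k, j) with hAm
  -- the torus element `diag(2, 3, 5, …)` and its lift
  set p : Fin m → ℕ := fun i => Nat.nth Nat.Prime i with hpdef
  have hprime : ∀ i, (p i).Prime := fun i => Nat.prime_nth_prime _
  have hpinj : Function.Injective p := fun _ _ h =>
    Fin.ext (Nat.nth_injective Nat.infinite_setOf_prime h)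
  have hp0 : ∀ i, ((fun i => (p i : ℂ)) i) ≠ 0 := fun i =>
    Nat.cast_ne_zero.2 (hprime i).ne_zero
  obtain ⟨g, h, hΛ, hw⟩ := exists_matrix_lift hA (diagUnit_mem ℂ (fun i => (p i : ℂ)) hp0)
  have hAt : ∀ k j, (g : Matrix (Fin n) (Fin n) ℂ) * Am k j =
      (p k : ℂ) • (Am ((1 : Equiv.Perm (Fin m)) k) j * (h : Matrix (Fin n) (Fin n) ℂ)) := by
    intro k j
    have e := hw (k, j)
    rw [coe_diagUnit, sum_kron_diagonal_smul] at e
    rw [mul_eq_of_eq_mul_mul_inv e, Matrix.smul_mul]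
    rfl
  let L : Lift (Matrix.toLin' Λm) (fun k j => Matrix.toLin' (Am k j)) 1 (fun k => (p k : ℂ)) :=
    liftOfMatrices Λm Am 1 _ hp0 g h hΛ hAt
  -- the permutation lifts
  have hperm : ∀ σ : Equiv.Perm (Fin m),
      Nonempty (Lift (Matrix.toLin' Λm) (fun k j => Matrix.toLin' (Am k j)) σ fun _ => (1 : ℂ)) := by
    intro σ
    obtain ⟨g', h', hΛ', hw'⟩ := exists_matrix_lift hA (permUnit_mem ℂ σ)
    refine ⟨liftOfMatrices Λm Am σ _ (fun _ => one_ne_zero) g' h' hΛ' fun k j => ?_⟩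
    have e := hw' (k, j)
    rw [coe_permUnit, sum_kron_permMatrix_smul] at e
    rw [mul_eq_of_eq_mul_mul_inv e, one_smul]
  -- regularity: the kernel of `Λ` is a line
  have hK : Module.finrank ℂ (LinearMap.ker (Matrix.toLin' Λm)) = 1 :=
    finrank_ker_toLin'_eq_one hn hreg.2
  obtain ⟨γ₀, hγ₀, hker⟩ := exists_eigenvalue_of_finrank_ker_eq_one _ L.C L.map_ker_eq hK
  -- the torus datum
  let D : TorusData m (Fin n → ℂ) :=
    { Λ := Matrix.toLin' Λm, A := fun k j => Matrix.toLin' (Am k j), p := p,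
      prime := hprime, p_inj := hpinj, L := L, γ₀ := γ₀, ker_le := hker, γ₀_ne := hγ₀ }
  -- an invertible member of the pencil: `Ã(v)`, of determinant `f(v) ≠ 0`
  have hgen : ∃ x : Fin m → Fin m → ℂ, Function.Injective (D.Λ + ∑ k, ∑ j, x k j • D.A k j) :=
    exists_injective_member_of_eval_ne_zero haff hdet hv
  have hmain := D.two_pow_sub_one_le_finrank hm hK hgen hperm
  rwa [Module.finrank_fin_fun] at hmain

end OneSided

/-! ### LR17 Thm. 2.1's engine for an arbitrary polynomial with the torus character and a regular
representation -/

section Character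

variable {m n : ℕ} {f : MvPolynomial (Fin m × Fin m) ℂ}
  {A : Matrix (Fin n) (Fin n) (MvPolynomial (Fin m × Fin m) ℂ)}

/-- **The determinant of a lift vs. the character, generic form** (LR17 Lemma 3.1,
`χ_{det_n}(g) = χ_P(ρ̄_A(g))`): if `γ · f = χ f` with `f ≠ 0`, and `(g, h)` is an exact lift of `γ`
for an affine determinantal representation `A` of `f`, then `det g · det h⁻¹ = χ` (the tree's
`det_mul_det_inv_eq_character` is the case `f = perm_m`, `γ = diag(d) ⊗ diag(e)`).
[cite: LandsbergRessayre2017, Lemma 3.1] -/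
theorem det_mul_det_inv_eq_of_linSubst_eq (hdetA : A.det = f) (hf : f ≠ 0)
    {γ : GL (Fin m × Fin m) ℂ} {χ : ℂ}
    (hχ : linSubst (Fin m × Fin m) ℂ (γ : Matrix (Fin m × Fin m) (Fin m × Fin m) ℂ) f = C χ * f)
    {g h : GL (Fin n) ℂ}
    (hgh : Matrix.linSubstEntries γ A =
      (g : Matrix (Fin n) (Fin n) ℂ).map C * A * ((h⁻¹ : GL (Fin n) ℂ) : Matrix (Fin n) (Fin n) ℂ).map C) :
    (g : Matrix (Fin n) (Fin n) ℂ).det * ((h⁻¹ : GL (Fin n) ℂ) : Matrix (Fin n) (Fin n) ℂ).det = χ := by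
  have h1 := linSubst_det_eq_of_linSubstEntries_eq hgh
  rw [hdetA, hχ] at h1
  have h2 := mul_right_cancel₀ hf h1
  exact (C_injective _ _ h2).symm

/-- **The top weight is the character, generic form** (LR17 §6, the character of `ℓ_2`; Lemma 3.1
+ Lemma 3.3): `A` an affine determinantal representation of `f ≠ 0` with regular constant part
(`rank Ã(0) = n - 1`), `γ · f = χ f`, `(g, h)` an exact lift of `γ`; if `h` has weight `γ₀` on
`ker Λ` and `β_top` is the weight of `g` on `ℂⁿ / range Λ`, then `β_top = χ γ₀` (the tree's
`top_eq_character_mul` is the case `f = perm_m`). [cite: LandsbergRessayre2017, §6] -/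
theorem top_eq_mul_of_linSubst_eq (hn : 0 < n) (hdetA : A.det = f) (hf : f ≠ 0)
    (hrank : (constPart A).rank = n - 1)
    {γ : GL (Fin m × Fin m) ℂ} {χ : ℂ}
    (hχ : linSubst (Fin m × Fin m) ℂ (γ : Matrix (Fin m × Fin m) (Fin m × Fin m) ℂ) f = C χ * f)
    {g h : GL (Fin n) ℂ}
    (hgh : Matrix.linSubstEntries γ A =
      (g : Matrix (Fin n) (Fin n) ℂ).map C * A * ((h⁻¹ : GL (Fin n) ℂ) : Matrix (Fin n) (Fin n) ℂ).map C)
    {γ₀ βt : ℂ}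
    (hγ₀ : LinearMap.ker (Matrix.toLin' (constPart A)) ≤
      maxGenEigenspace (Matrix.toLin' (h : Matrix (Fin n) (Fin n) ℂ)) γ₀)
    (hβ : ∀ β, β ≠ βt → maxGenEigenspace (Matrix.toLin' (g : Matrix (Fin n) (Fin n) ℂ)) β ≤
      LinearMap.range (Matrix.toLin' (constPart A))) :
    βt = χ * γ₀ := by
  have e1 : (g : Matrix (Fin n) (Fin n) ℂ) * constPart A = constPart A * (h : Matrix (Fin n) (Fin n) ℂ) :=
    mul_constPart_eq_of_linSubstEntries_eq hgh
  have hchar := det_mul_det_inv_eq_of_linSubst_eq hdetA hf hχ hgh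
  have hid := det_mul_eq_det_mul_top hn hrank e1 hγ₀ hβ
  -- `det h ≠ 0` and `det h⁻¹ = (det h)⁻¹`
  have hhdet : (h : Matrix (Fin n) (Fin n) ℂ).det * ((h⁻¹ : GL (Fin n) ℂ) : Matrix (Fin n) (Fin n) ℂ).det = 1 := by
    rw [← Matrix.det_mul, ← Units.val_mul, mul_inv_cancel, Units.val_one, Matrix.det_one]
  have hh0 : (h : Matrix (Fin n) (Fin n) ℂ).det ≠ 0 := left_ne_zero_of_mul_eq_one hhdet
  -- `det g = χ det h`
  have hg : (g : Matrix (Fin n) (Fin n) ℂ).det = χ * (h : Matrix (Fin n) (Fin n) ℂ).det := by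
    calc (g : Matrix (Fin n) (Fin n) ℂ).det
        = (g : Matrix (Fin n) (Fin n) ℂ).det * ((h : Matrix (Fin n) (Fin n) ℂ).det *
            ((h⁻¹ : GL (Fin n) ℂ) : Matrix (Fin n) (Fin n) ℂ).det) := by rw [hhdet, mul_one]
      _ = ((g : Matrix (Fin n) (Fin n) ℂ).det * ((h⁻¹ : GL (Fin n) ℂ) : Matrix (Fin n) (Fin n) ℂ).det) *
            (h : Matrix (Fin n) (Fin n) ℂ).det := by ring
      _ = χ * (h : Matrix (Fin n) (Fin n) ℂ).det := by rw [hchar]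
  rw [hg] at hid
  -- cancel `det h`
  have : (h : Matrix (Fin n) (Fin n) ℂ).det * (χ * γ₀) = (h : Matrix (Fin n) (Fin n) ℂ).det * βt := by
    rw [← hid]; ring
  exact (mul_left_cancel₀ hh0 this).symm

/-- **The top weight of a lift is the character, unconditionally, generic form**: with the data of
`top_eq_mul_of_linSubst_eq`, EVERY weight space `E β` of `g` with `β ≠ χ γ₀` lies in `range Λ`
(the tree's `maxGenEigenspace_le_range_of_ne_character` is the case `f = perm_m`).
[cite: LandsbergRessayre2017, §6] -/
theorem maxGenEigenspace_le_range_of_linSubst_eq (hn : 0 < n) (hdetA : A.det = f) (hf : f ≠ 0)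
    (hrank : (constPart A).rank = n - 1)
    {γ : GL (Fin m × Fin m) ℂ} {χ : ℂ}
    (hχ : linSubst (Fin m × Fin m) ℂ (γ : Matrix (Fin m × Fin m) (Fin m × Fin m) ℂ) f = C χ * f)
    {g h : GL (Fin n) ℂ}
    (hgh : Matrix.linSubstEntries γ A =
      (g : Matrix (Fin n) (Fin n) ℂ).map C * A * ((h⁻¹ : GL (Fin n) ℂ) : Matrix (Fin n) (Fin n) ℂ).map C)
    {γ₀ : ℂ}
    (hγ₀ : LinearMap.ker (Matrix.toLin' (constPart A)) ≤
      maxGenEigenspace (Matrix.toLin' (h : Matrix (Fin n) (Fin n) ℂ)) γ₀) :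
    ∀ β, β ≠ χ * γ₀ →
      maxGenEigenspace (Matrix.toLin' (g : Matrix (Fin n) (Fin n) ℂ)) β ≤
        LinearMap.range (Matrix.toLin' (constPart A)) := by
  have e1 : (g : Matrix (Fin n) (Fin n) ℂ) * constPart A = constPart A * (h : Matrix (Fin n) (Fin n) ℂ) :=
    mul_constPart_eq_of_linSubstEntries_eq hgh
  obtain ⟨βt, hβt⟩ := exists_top_of_map_range_le (Matrix.toLin' (constPart A))
    (Matrix.toLin' (g : Matrix (Fin n) (Fin n) ℂ)) (map_range_toLin'_le e1)
    (finrank_ker_toLin'_eq_one hn hrank)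
  have := top_eq_mul_of_linSubst_eq hn hdetA hf hrank hχ hgh hγ₀ hβt
  rw [← this]
  exact hβt

end Character

section TwoSided

variable {m n : ℕ} {f : MvPolynomial (Fin m × Fin m) ℂ}
  {A : Matrix (Fin n) (Fin n) (MvPolynomial (Fin m × Fin m) ℂ)}

/-- **The two-sided torus datum of a regular equivariant representation, with all count
hypotheses, generic form** (LR17 §6 for Thm. 2.1 / Thm. 2.13; the tree's `exists_torusData₂` with
`perm_m ↦ f`): for `A` a REGULAR affine determinantal representation of `f` over `ℂ` of size
`n ≥ 1`, equivariant (exact lifts) for the monomial pairs `permSymmetrySubst`, with `f(v) ≠ 0` for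
some `v` and `f` rescaled by the torus through its character
(`(diag(d) ⊗ diag(e)) · f = (∏ d ∏ e) f`), there is a `TorusData₂` on `ℂⁿ` with `Λ = Ã(0)`,
`A k j = A_{kj}` such that (i) `dim ker Λ = 1`, (ii) some member of the pencil is injective,
(iii) every permutation pair `(σ, π)` has an exact `Lift₂`, and (iv) the top weight is `wt 1`:
`β ≠ wt (1,…,1) ⇒ E β ⊆ range Λ`. [cite: LandsbergRessayre2017, §6] -/
theorem exists_torusData₂_of_isRegular
    (hA : IsEquivariantDetRepr (permSymmetrySubst ℂ m) f A) (hreg : IsRegularDetRepr f A)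
    (hn : 0 < n)
    (hχ : ∀ d e : Fin m → ℂ,
      linSubst (Fin m × Fin m) ℂ (Matrix.diagonal d ⊗ₖ Matrix.diagonal e) f = C ((∏ k, d k) * ∏ j, e j) * f)
    {v : Fin m × Fin m → ℂ} (hv : MvPolynomial.eval v f ≠ 0) :
    ∃ D : TorusData₂ m (Fin n → ℂ),
      D.Λ = Matrix.toLin' (constPart A) ∧
      D.A = (fun k j => Matrix.toLin' (coeffMat A (k, j))) ∧
      D.r = primes₂ m ∧
      Module.finrank ℂ (LinearMap.ker D.Λ) = 1 ∧
      (∃ x : Fin m → Fin m → ℂ, Function.Injective (D.Λ + ∑ k, ∑ j, x k j • D.A k j)) ∧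
      (∀ σ π : Equiv.Perm (Fin m), Nonempty (Lift₂ D.Λ D.A σ π fun _ => (1 : ℂ))) ∧
      (∀ β, β ≠ D.wt (fun _ => 1) → D.E β ≤ LinearMap.range D.Λ) := by
  classical
  have haff : ∀ r c, (A r c).totalDegree ≤ 1 := hA.1.1
  have hdet : A.det = f := hA.1.2
  have hf : f ≠ 0 := ne_zero_of_eval_ne_zero hv
  have hrank : (constPart A).rank = n - 1 := hreg.2
  set Λm : Matrix (Fin n) (Fin n) ℂ := constPart A with hΛm
  set Am : Fin m → Fin m → Matrix (Fin n) (Fin n) ℂ := fun k j => coeffMat A (k, j) with hAm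
  -- the torus pair `diag(p) ⊗ diag(q)` with `p ⊔ q = primes₂ m`, and its lift
  set r : Fin m ⊕ Fin m → ℕ := primes₂ m with hr
  set d : Fin m → ℂ := fun k => (r (Sum.inl k) : ℂ) with hd
  set e : Fin m → ℂ := fun j => (r (Sum.inr j) : ℂ) with he
  have hd0 : ∀ i, d i ≠ 0 := fun i => primes₂_cast_ne_zero m _
  have he0 : ∀ i, e i ≠ 0 := fun i => primes₂_cast_ne_zero m _
  obtain ⟨P, Q, hPQ, hΛ, hkj⟩ := exists_torusPair_matrices hA d e hd0 he0
  have hc : ∀ x : Fin m ⊕ Fin m, ((fun x => (r x : ℂ)) x) ≠ 0 := fun x => primes₂_cast_ne_zero m x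
  have hkj' : ∀ k j, (P : Matrix (Fin n) (Fin n) ℂ) * Am k j =
      ((fun x => (r x : ℂ)) (Sum.inl k) * (fun x => (r x : ℂ)) (Sum.inr j)) •
        (Am ((1 : Equiv.Perm (Fin m)) k) ((1 : Equiv.Perm (Fin m)) j) * (Q : Matrix (Fin n) (Fin n) ℂ)) :=
    fun k j => hkj k j
  let L : Lift₂ (Matrix.toLin' Λm) (fun k j => Matrix.toLin' (Am k j)) 1 1 (fun x => (r x : ℂ)) :=
    lift₂OfMatrices Λm Am 1 1 _ hc P Q hΛ hkj'
  -- regularity: the kernel of `Λ` is a line, `C` acts on it by `γ₀`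
  have hK : Module.finrank ℂ (LinearMap.ker (Matrix.toLin' Λm)) = 1 := finrank_ker_toLin'_eq_one hn hrank
  obtain ⟨γ₀, hγ₀, hker⟩ := exists_eigenvalue_of_finrank_ker_eq_one _ L.C L.map_ker_eq hK
  -- the datum
  let D : TorusData₂ m (Fin n → ℂ) :=
    { Λ := Matrix.toLin' Λm, A := fun k j => Matrix.toLin' (Am k j), r := r,
      prime := primes₂_prime m, r_inj := primes₂_injective m, L := L, γ₀ := γ₀, ker_le := hker,
      γ₀_ne := hγ₀ }
  refine ⟨D, rfl, rfl, rfl, hK, exists_injective_member_of_eval_ne_zero haff hdet hv,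
    fun σ π => nonempty_lift₂_permPair hA σ π, ?_⟩
  -- (iv) the top weight is the character
  have htop := maxGenEigenspace_le_range_of_linSubst_eq hn hdet hf hrank
    (γ := Matrix.GeneralLinearGroup.kronecker (diagUnit ℂ d hd0) (diagUnit ℂ e he0))
    (by rw [coe_kronecker_diagUnit d e hd0 he0]; exact hχ d e) hPQ hker
  have hwt : D.wt (fun _ => 1) = ((∏ k, d k) * ∏ j, e j) * γ₀ := by
    show γ₀ * ∏ x, (r x : ℂ) ^ (fun _ : Fin m ⊕ Fin m => 1) x = ((∏ k, d k) * ∏ j, e j) * γ₀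
    simp only [pow_one]
    rw [Fintype.prod_sum_type, mul_comm]
  intro β hβ
  rw [hwt] at hβ
  exact htop β hβ

/-- **LR17 Thm. 2.1 / Thm. 2.13, lower bound, for one regular representation, generic form**: a
REGULAR affine determinantal representation of `f` on `M_m(ℂ)` (`m ≥ 1`, size `n ≥ 1`) which is
equivariant (exact lifts) for the monomial pairs `permSymmetrySubst`, with `f(v) ≠ 0` for some `v` and
the torus character identity, has size `n ≥ C(2m, m) - 1` (`TorusData₂.choose_sub_one_le_finrank`
on the datum of `exists_torusData₂_of_isRegular`; the tree's `choose_sub_one_le_of_isEquivariantDetRepr`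
is the case `f = perm_m`, where regularity is von zur Gathen's theorem).
[cite: LandsbergRessayre2017, Thm. 2.13] -/
theorem choose_sub_one_le_of_isRegular (hm : 1 ≤ m)
    (hA : IsEquivariantDetRepr (permSymmetrySubst ℂ m) f A) (hreg : IsRegularDetRepr f A)
    (hn : 0 < n)
    (hχ : ∀ d e : Fin m → ℂ,
      linSubst (Fin m × Fin m) ℂ (Matrix.diagonal d ⊗ₖ Matrix.diagonal e) f = C ((∏ k, d k) * ∏ j, e j) * f)
    {v : Fin m × Fin m → ℂ} (hv : MvPolynomial.eval v f ≠ 0) :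
    Nat.choose (2 * m) m - 1 ≤ n := by
  obtain ⟨D, -, -, -, hK, hgen, hperm, htop⟩ := exists_torusData₂_of_isRegular hA hreg hn hχ hv
  have h := D.choose_sub_one_le_finrank hm hK hgen hperm htop
  rwa [Module.finrank_fin_fun] at h

end TwoSided

/-! ### The determinant: character, value at the identity -/

section Det

variable {m : ℕ}

/-- **The torus rescales the determinant by its character**: substituting `x_{kj} ↦ d_k e_j x_{kj}`
(the element `diag(d) ⊗ diag(e)` of `T(E) × T(F) ≤ GL(E) × GL(F)`) multiplies `det_m` by
`∏ d · ∏ e` (`det(diag(d) x diag(e)) = det diag(d) · det x · det diag(e)`; LR17 §1, `χ_{det_m}`).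
[cite: LandsbergRessayre2017, §1 (𝔾_{det_n})] -/
theorem linSubst_diagonal_detPoly (d e : Fin m → ℂ) :
    linSubst (Fin m × Fin m) ℂ (Matrix.diagonal d ⊗ₖ Matrix.diagonal e) (detPoly (Fin m) ℂ) =
      C ((∏ k, d k) * ∏ j, e j) * detPoly (Fin m) ℂ := by
  classical
  have hX : ∀ i j : Fin m, linSubst (Fin m × Fin m) ℂ (Matrix.diagonal d ⊗ₖ Matrix.diagonal e) (X (i, j)) =
      C (d i) * C (e j) * X (i, j) := by
    intro i j
    rw [linSubst_X, Matrix.diagonal_kronecker_diagonal, Finset.sum_eq_single (i, j)]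
    · rw [Matrix.diagonal_apply_eq, smul_eq_C_mul, map_mul]
    · intro w _ hw
      rw [Matrix.diagonal_apply_ne _ hw, zero_smul]
    · intro hv; exact absurd (Finset.mem_univ _) hv
  have hmat : (Matrix.mvPolynomialX (Fin m) (Fin m) ℂ).map
      (linSubst (Fin m × Fin m) ℂ (Matrix.diagonal d ⊗ₖ Matrix.diagonal e)) =
      Matrix.diagonal (fun i => C (d i)) * Matrix.mvPolynomialX (Fin m) (Fin m) ℂ *
        Matrix.diagonal (fun j => C (e j)) := by
    refine Matrix.ext fun i j => ?_
    rw [Matrix.map_apply, Matrix.mvPolynomialX_apply, hX, Matrix.mul_diagonal, Matrix.diagonal_mul,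
      Matrix.mvPolynomialX_apply]
    ring
  unfold detPoly
  rw [AlgHom.map_det, AlgHom.mapMatrix_apply, hmat, Matrix.det_mul, Matrix.det_mul,
    Matrix.det_diagonal, Matrix.det_diagonal, map_mul, map_prod, map_prod]
  ring

/-- `det_m` vanishes at the origin (`m ≥ 1`). [folklore] -/
private theorem eval_zero_detPoly (hm : 1 ≤ m) : MvPolynomial.eval (0 : Fin m × Fin m → ℂ) (detPoly (Fin m) ℂ) = 0 := by
  haveI : Nonempty (Fin m) := ⟨⟨0, hm⟩⟩
  rw [eval_detPoly]
  have hz : (Matrix.of fun i j : Fin m => (0 : Fin m × Fin m → ℂ) (i, j)) = 0 := by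
    ext i j; rfl
  rw [hz, Matrix.det_zero]

/-- `det_m(Id) = 1 ≠ 0`. [folklore] -/
private theorem eval_one_detPoly_ne_zero :
    MvPolynomial.eval (fun w : Fin m × Fin m => if w.1 = w.2 then (1 : ℂ) else 0) (detPoly (Fin m) ℂ) ≠ 0 := by
  rw [eval_detPoly]
  have h1 : (Matrix.of fun i j : Fin m => (fun w : Fin m × Fin m => if w.1 = w.2 then (1 : ℂ) else 0) (i, j)) = 1 := by
    ext i j; simp [Matrix.one_apply]
  rw [h1, Matrix.det_one]; exact one_ne_zero

end Det

end LRPencil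

/-! ## Assembly: the two named facts hold -/

open LRPencil
open scoped Kronecker

/-- `N(T^{GL(F)}) ≤ GL(F)`: the right monomial symmetries are right linear symmetries (companion of
the tree's `leftMonomialSubst_le_leftLinearSubst`). [cite: LandsbergRessayre2017, §2.2] -/
theorem rightMonomialSubst_le_rightLinearSubst (k : Type*) [Field k] (m : ℕ) :
    rightMonomialSubst k m ≤ rightLinearSubst k m := by
  refine Subgroup.closure_mono ?_
  rintro γ ⟨h, -, hh⟩
  exact ⟨h, hh⟩

/-- The monomial symmetry group realised for `perm_m` lies in the realised symmetry group of `det_m`: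
`(N(T^{GL(E)}) × N(T^{GL(F)})) ⋊ ℤ₂ ≤ (GL(E) × GL(F)) ⋊ ℤ₂` (LR17 §1–§2.1: monomial matrices are
invertible, the transposition is common to both). [cite: LandsbergRessayre2017, §1 (𝔾_{det_n})] -/
theorem permSymmetrySubst_le_detSymmetrySubst (k : Type*) [Field k] (m : ℕ) :
    permSymmetrySubst k m ≤ detSymmetrySubst k m := by
  refine Subgroup.closure_mono (Set.union_subset_union (Set.union_subset_union ?_ ?_) subset_rfl)
  · exact SetLike.coe_subset_coe.2 (leftMonomialSubst_le_leftLinearSubst k m)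
  · exact SetLike.coe_subset_coe.2 (rightMonomialSubst_le_rightLinearSubst k m)

/-- **LR17 Thm. 2.14, lower bound, for one representation**: a REGULAR affine determinantal
representation of `det_m` over `ℂ` equivariant (exact lifts) for left multiplication by `GL(E)` has
size `n ≥ 2^m - 1` (no restriction on `m`). [cite: LandsbergRessayre2017, Thm. 2.14] -/
theorem two_pow_sub_one_le_of_isRegular_detPoly {m n : ℕ}
    {A : Matrix (Fin n) (Fin n) (MvPolynomial (Fin m × Fin m) ℂ)}
    (hreg : IsRegularDetRepr (detPoly (Fin m) ℂ) A)
    (hA : IsEquivariantDetRepr (leftLinearSubst ℂ m) (detPoly (Fin m) ℂ) A) : 2 ^ m - 1 ≤ n := by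
  rcases Nat.eq_zero_or_pos m with rfl | hm
  · simp
  exact two_pow_sub_one_le_of_isRegular_of_eval_ne_zero hm
    (hA.anti (leftMonomialSubst_le_leftLinearSubst ℂ m)) hreg
    (pos_of_det_eq_of_eval_zero hreg.1.2 (eval_zero_detPoly hm)) eval_one_detPoly_ne_zero

/-- **DISCHARGE of the named fact `lr_thm_2_14_ge`** (Landsberg–Ressayre 2017, Thm. 2.14, `≥`,
p0006:L135–L139): "Let `Ã_m` be a regular determinantal representation of `det_m` that respects
`GL(E)`.  Then `n ≥ 2^m - 1`."  Proof in the tree: the elementary Thm. 2.8 engine (canonical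
subspaces, one generic torus element of `T^{GL(E)} ≤ GL(E)`, permutation lifts, weight count
`2^m - 1`) with regularity as given. [cite: LandsbergRessayre2017, Thm. 2.14] -/
theorem lr_thm_2_14_ge_holds : lr_thm_2_14_ge :=
  fun _ _ _ hreg hA => two_pow_sub_one_le_of_isRegular_detPoly hreg hA

/-- **LR17 Thm. 2.13, lower bound, for one representation**: a REGULAR affine determinantal
representation of `det_m` over `ℂ` equivariant (exact lifts) for the full realised symmetry group
`𝔾_{det_m}` (`detSymmetrySubst`) has size `n ≥ C(2m, m) - 1` (no restriction on `m`; only the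
monomial pairs are used, not the transposition). [cite: LandsbergRessayre2017, Thm. 2.13] -/
theorem choose_sub_one_le_of_isRegular_detPoly {m n : ℕ}
    {A : Matrix (Fin n) (Fin n) (MvPolynomial (Fin m × Fin m) ℂ)}
    (hreg : IsRegularDetRepr (detPoly (Fin m) ℂ) A)
    (hA : IsEquivariantDetRepr (detSymmetrySubst ℂ m) (detPoly (Fin m) ℂ) A) :
    Nat.choose (2 * m) m - 1 ≤ n := by
  rcases Nat.eq_zero_or_pos m with rfl | hm
  · simp
  exact choose_sub_one_le_of_isRegular hm (hA.anti (permSymmetrySubst_le_detSymmetrySubst ℂ m)) hreg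
    (pos_of_det_eq_of_eval_zero hreg.1.2 (eval_zero_detPoly hm)) linSubst_diagonal_detPoly
    eval_one_detPoly_ne_zero

/-- **DISCHARGE of the named fact `lr_thm_2_13_ge`** (Landsberg–Ressayre 2017, Thm. 2.13, `≥`,
p0006:L127–L129: "`srdc(det_m) = C(2m,m) - 1`", lower half; the printed proof is omitted as "very
similar" to that of Thm. 2.14): every regular affine determinantal representation of `det_m` over `ℂ`
equivariant for `𝔾_{det_m}` has size `≥ C(2m, m) - 1`.  Proof in the tree: the elementary
two-sided Thm. 2.1 engine (two-sided torus datum, pinned top character `∏ p ∏ q · γ₀`, chain with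
profiles, count `Σ_s C(m,s)² + 1 = C(2m,m) - 1`) with regularity as given.
[cite: LandsbergRessayre2017, Thm. 2.13] -/
theorem lr_thm_2_13_ge_holds : lr_thm_2_13_ge :=
  fun _ _ _ hreg hA => choose_sub_one_le_of_isRegular_detPoly hreg hA

/-! ## LR17 Thms. 2.14 and 2.13 as equalities (appended) -/

/-- **LR17 Thm. 2.14 in full, UNCONDITIONALLY** (p0006:L135–L142): for `m ≥ 1` the regular
`GL(E)`-equivariant determinantal complexity of `det_m` is exactly `2^m - 1` — the upper half is
Prop. 2.16 (`lr_prop_2_16_holds`, `LR17ExteriorDetReprEquivariance.lean`), the lower half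
`lr_thm_2_14_ge_holds` above; this feeds `LR17.regularEquivariantDetComplexity_detPoly_eq` its last
hypothesis. [cite: LandsbergRessayre2017, Thm. 2.14] -/
theorem LR17.regularEquivariantDetComplexity_detPoly_eq_two_pow_sub_one {m : ℕ} (hm : 1 ≤ m) :
    regularEquivariantDetComplexity (leftLinearSubst ℂ m) (detPoly (Fin m) ℂ) = 2 ^ m - 1 :=
  LR17.regularEquivariantDetComplexity_detPoly_eq lr_thm_2_14_ge_holds hm

/-- **LR17 Thm. 2.13 as an equality, modulo the construction only** (p0006:L127–L129,
"`\srdc(det_m) = C(2m,m) - 1`"): granted Prop. 2.17 (the named fact `lr_prop_2_17`, the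
`𝔾_{det_m}`-equivariant regular representation of size `C(2m,m) - 1`), `srdc(det_m) = C(2m,m) - 1` for
`m ≥ 1`; the lower bound is `lr_thm_2_13_ge_holds` above. [cite: LandsbergRessayre2017, Thm. 2.13] -/
theorem lr_thm_2_13_eq_of_prop_2_17 (h17 : lr_prop_2_17) {m : ℕ} (hm : 1 ≤ m) :
    regularEquivariantDetComplexity (detSymmetrySubst ℂ m) (detPoly (Fin m) ℂ) = (2 * m).choose m - 1 :=
  lr_thm_2_13_eq h17 lr_thm_2_13_ge_holds hm

end Literature.Computability.AlgebraicComplexity
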